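import Mathlib.Analysis.SpecialFunctions.Pow.Real
import Literature.Computability.AlgebraicComplexity.GKSS19KroneckerSplitting
import Literature.Computability.AlgebraicComplexity.GKSS19MainThmHolds
import Literature.Computability.AlgebraicComplexity.MS21UniformSVGenerator
import Literature.Barriers.ValiantsHypothesis.FSV18UniversalConstructions
import HarnessLib

/-!
# GKSS19 ‹Thm 5› (constant `k`), mathematical half: the grid image of `G_Q` hits `𝒞(s, s, s)`

Guo–Kumar–Saptharishi–Solomon, *Derandomization from algebraic hardness* (arXiv:1905.00091), proof
of ‹Thm 25› = ‹Thm 5› for constant `k` (arXiv p0013.txt:L10-36): from the explicit hard family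
`P_{k,d}` one passes to the split polynomial `Q = Q_{k,d,t}` (`GKSS19KroneckerSplitting.lean`), which
is still hard ("a contradiction to the hardness of `P_{k,d}`"), so that by the main theorem
(‹G_P is an HSG›, tree `GKSS2019_mainThm_holds`) "`G_{Q_{k,d,t}}` is a hitting-set generator for the
class `𝒞(s,s,s)`. Therefore, from (lem:Schwartz-Zippel), this yields an explicit hitting set of
size at most `(s d' + 1)^{2t·k} = s^{O(k²)}`" (constant `k`, `δ`).

This file (theorems + definitions with bodies, NO named facts) builds that hitting set as a LIST
of rational points and proves it hits:
* `eval_sumElim_delta`: `Δ_j(Q)(a, b) = coeff_{T^j} Q(a + T·b)` (the evaluation rule the explicit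
  machine of `GKSS19Thm5Explicit.lean` implements), `degreeOf_delta_le`;
* `gridLists n W` (the grid `{0,…,W-1}^n` as lists), `natPt`, `row`, `gridImage Q s W`
  (the list `G_Q({0..W-1}^{2m})`, first `s` coordinates), `gridImage_hits` (generator + degree
  bound ⟹ the grid image hits, via the tree's MS Obs 18 / Alon grid lemma), `smallList`
  (the trivial hitting set `{0..s}^s` used below a threshold), `smallList_hits`;
* the parameters of the proof for constant `k`: `tOf c δ = ⌈6(c+1)/δ⌉₊ + 1` blocks (the printed
  `t = ⌈8/δ⌉` is for the printed exponent `4`; the tree's main theorem has an abstract exponent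
  `c`), `EOf k t = 4kt + 2`, `beta E s = E(⌊log₂ s⌋ + 1)` (base `B = 2^β`, so that the substitution
  `z_{v,i} ↦ z_v^{B^i}` costs `β·i` squarings), `dOf t E s = s^{tE}` (the degree `d` used at size
  `s`; printed: "the smallest `d` such that `d > s^{(10t·k(d)+2)·t}`"), `Qof P t E s`, `WOf`,
  `mainList`, `hitList`;
* `isGeneratorFor_Qof`: for all large `s = n+1`, `G_{Q(s)}` is a generator for
  `vpSlice ℚ s s s` (hardness transfer + parameter arithmetic + `GKSS2019_mainThm_holds`);
* `hitList_hits`, `length_hitList_le` (size `≤ s^C + C`).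

HONEST FRAMING: characteristic zero is used through `ℚ` only (the typed ‹Thm 5› is over `ℚ`);
nothing here bears on VP ≠ VNP.

## References
* [GuoKumarSaptharishiSolomon2019] arXiv:1905.00091, Thm 5 (p.5), proof of Thm 25 (p.13 L10-36).
* [MediniShpilka2021] D. Medini, A. Shpilka, Hitting sets and reconstruction for dense orbits in
  VP_e and ΣΠΣ circuits, CCC 2021, Obs 18 (generators give hitting sets) — tree
  `MS2021.degreeOf_bind₁_le`, `MS2021.exists_eval_ne_zero_of_degreeOf_lt`.
-/

noncomputable section

open MvPolynomial Filter

namespace Literature.Computability.AlgebraicComplexity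

namespace GKSS2019

open Literature.Barriers.ValiantsHypothesis HittingSets

/-! ### `Δ_j(Q)(a, b)` is the `T^j`-coefficient of `Q(a + T b)` -/

section DeltaEval

variable {F : Type*} [CommRing F] {m : ℕ}

/-- The line substitution `z_w ↦ a_w + b_w·T` into `F[T]`. [cite: GuoKumarSaptharishiSolomon2019, Def 9 (arXiv p0006.txt:L44-48, "Taylor expansion of P(z + y)")] -/
def lineSubst (a b : Fin m → F) : Fin m → Polynomial F :=
  fun w => Polynomial.C (a w) + Polynomial.C (b w) * Polynomial.X

/-- The substitution `z ↦ a`, `y ↦ b·T` on `F[z ⊔ y]`. [folklore] -/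
private def lineMap (a b : Fin m → F) : Fin m ⊕ Fin m → Polynomial F :=
  Sum.elim (fun v => Polynomial.C (a v)) (fun v => Polynomial.C (b v) * Polynomial.X)

/-- Powers of the substituted variables. [folklore] -/
private theorem lineMap_pow (a b : Fin m → F) (w : Fin m ⊕ Fin m) (e : ℕ) :
    lineMap a b w ^ e = Polynomial.C ((Sum.elim a b w) ^ e) * Polynomial.X ^ (e * yWeight m w) := by
  cases w with
  | inl v => simp [lineMap, yWeight]
  | inr v => simp [lineMap, yWeight, mul_pow]

/-- The substitution on a monomial: `c·a^{u_z} b^{u_y} · T^{|u_y|}`. [folklore] -/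
private theorem aeval_lineMap_monomial (a b : Fin m → F) (u : Fin m ⊕ Fin m →₀ ℕ) (c : F) :
    aeval (lineMap a b) (monomial u c) =
      Polynomial.C (c * ∏ w ∈ u.support, (Sum.elim a b w) ^ u w) *
        Polynomial.X ^ (Finsupp.weight (yWeight m) u) := by
  classical
  rw [aeval_monomial, Finsupp.prod, Polynomial.algebraMap_eq]
  simp_rw [lineMap_pow]
  rw [Finset.prod_mul_distrib, ← map_prod Polynomial.C, Finset.prod_pow_eq_pow_sum,
    Finsupp.weight_apply, Finsupp.sum, map_mul, mul_assoc]
  simp [smul_eq_mul]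

/-- The `y`-weight-`j` component of a monomial. [folklore] -/
private theorem weightedHomogeneousComponent_monomial' (j : ℕ) (u : Fin m ⊕ Fin m →₀ ℕ) (c : F) :
    weightedHomogeneousComponent (yWeight m) j (monomial u c) =
      if Finsupp.weight (yWeight m) u = j then monomial u c else 0 := by
  classical
  ext d
  rw [coeff_weightedHomogeneousComponent]
  by_cases hud : u = d
  · subst hud
    split_ifs <;> simp
  · rw [coeff_monomial, if_neg hud]
    split_ifs with h1 h2
    · rw [coeff_monomial, if_neg hud]
    · rfl
    · rw [coeff_monomial, if_neg hud]
    · simp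

/-- Coefficients of the line substitution are evaluations of the `y`-weight components. [folklore] -/
private theorem coeff_aeval_lineMap (a b : Fin m → F) (R : MvPolynomial (Fin m ⊕ Fin m) F) (j : ℕ) :
    (aeval (lineMap a b) R).coeff j =
      eval (Sum.elim a b) (weightedHomogeneousComponent (yWeight m) j R) := by
  classical
  refine MvPolynomial.induction_on' R (fun u c => ?_) (fun p q hp hq => ?_)
  · rw [aeval_lineMap_monomial, Polynomial.coeff_C_mul_X_pow,
      weightedHomogeneousComponent_monomial']
    by_cases h : Finsupp.weight (yWeight m) u = j
    · rw [if_pos h.symm, if_pos h, eval_monomial, Finsupp.prod]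
    · rw [if_neg (Ne.symm h), if_neg h, map_zero]
  · rw [map_add, Polynomial.coeff_add, map_add, map_add, hp, hq]

/-- **`Δ_j(Q)(a, b) = coeff_{T^j} Q(a + T b)`**: evaluating the `y`-degree-`j` Taylor component of
`Q(z + y)` at `(z, y) = (a, b)` reads off the `T^j`-coefficient of the univariate restriction
`Q(a + T b)`. [cite: GuoKumarSaptharishiSolomon2019, Def 9 (arXiv p0006.txt:L44-48, "Δ_i(P)(z,y) … homogeneous degree i (in y) component in the Taylor expansion of P(z + y)")] -/
theorem eval_sumElim_delta (Q : MvPolynomial (Fin m) F) (a b : Fin m → F) (j : ℕ) :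
    eval (Sum.elim a b) (delta Q j) = (aeval (lineSubst a b) Q).coeff j := by
  rw [delta, ← coeff_aeval_lineMap]
  congr 1
  rw [shifted, ← AlgHom.comp_apply, comp_aeval]
  have hfun : (fun i : Fin m => aeval (lineMap a b)
      (X (Sum.inl i) + X (Sum.inr i) : MvPolynomial (Fin m ⊕ Fin m) F)) = lineSubst a b := by
    funext w; simp [lineMap, lineSubst]
  rw [hfun]

/-- `deg_v Δ_j(Q) ≤ deg Q` for every seed variable `v`. [cite: GuoKumarSaptharishiSolomon2019, §3.2 (arXiv p0013.txt:L25-27, degree count "(sd'+1)^{2t·k}")] -/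
theorem degreeOf_delta_le [Nontrivial F] (Q : MvPolynomial (Fin m) F) (j : ℕ) (v : Fin m ⊕ Fin m) :
    degreeOf v (delta Q j) ≤ Q.totalDegree := by
  classical
  refine (degreeOf_le_totalDegree _ _).trans ?_
  have hsub : (delta Q j).support ⊆ (shifted Q).support := fun d hd => by
    rw [mem_support_iff] at hd ⊢
    rw [delta, coeff_weightedHomogeneousComponent] at hd
    split_ifs at hd with h
    · exact hd
    · exact (hd rfl).elim
  have h1 : (delta Q j).totalDegree ≤ (shifted Q).totalDegree := by
    rw [totalDegree, totalDegree]
    exact Finset.sup_mono hsub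
  refine h1.trans ?_
  rw [shifted, aeval_eq_bind₁]
  have h2 := FSV2018.totalDegree_bind₁_le_mul
    (fun j : Fin m => (X (Sum.inl j) + X (Sum.inr j) : MvPolynomial (Fin m ⊕ Fin m) F)) 1
    (fun j => (totalDegree_add _ _).trans (max_le (by rw [totalDegree_X]) (by rw [totalDegree_X]))) Q
  simpa using h2

end DeltaEval

/-! ### Grids as lists and the grid image of `G_Q` -/

section Grid

/-- The grid `{0, …, W-1}^n` as a list of lists. [cite: GuoKumarSaptharishiSolomon2019, §3.2 (arXiv p0013.txt:L24-25, "(lem:Schwartz-Zippel) … explicit hitting set")] -/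
def gridLists : ℕ → ℕ → List (List ℕ)
  | 0, _ => [[]]
  | n + 1, W => ((List.range W).product (gridLists n W)).map fun p => p.1 :: p.2

/-- Membership in the grid list. [folklore] [cite: GuoKumarSaptharishiSolomon2019, §3.2 (arXiv p0013.txt:L24-25)] -/
theorem mem_gridLists {n W : ℕ} {l : List ℕ} : l ∈ gridLists n W ↔ l.length = n ∧ ∀ x ∈ l, x < W := by
  induction n generalizing l with
  | zero => cases l <;> simp [gridLists]
  | succ n ih =>
    cases l with
    | nil => simp [gridLists]
    | cons a l =>
      simp only [gridLists, List.mem_map, Prod.exists, List.cons.injEq, List.length_cons,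
        Nat.add_right_cancel_iff, List.mem_cons, forall_eq_or_imp]
      constructor
      · rintro ⟨a', l', hm, rfl, rfl⟩
        have hm' := List.pair_mem_product.mp hm
        exact ⟨(ih.mp hm'.2).1, List.mem_range.mp hm'.1, (ih.mp hm'.2).2⟩
      · rintro ⟨hl, ha, hx⟩
        exact ⟨a, l, List.pair_mem_product.mpr ⟨List.mem_range.mpr ha, ih.mpr ⟨hl, hx⟩⟩, rfl, rfl⟩

/-- `|{0..W-1}^n| = W^n`. [cite: GuoKumarSaptharishiSolomon2019, §3.2 (arXiv p0013.txt:L27 "(sd'+1)^{2t·k}")] -/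
theorem length_gridLists (n W : ℕ) : (gridLists n W).length = W ^ n := by
  induction n with
  | zero => simp [gridLists]
  | succ n ih =>
    rw [gridLists, List.length_map]
    show (List.range W ×ˢ gridLists n W).length = _
    rw [List.length_product, List.length_range, ih, pow_succ']

variable {m : ℕ}

/-- The rational seed point `(z, y) = (l[0..m), l[m..2m))` of a grid list. [cite: GuoKumarSaptharishiSolomon2019, §3.2 (arXiv p0013.txt:L24-27)] -/
def natPt (m : ℕ) (l : List ℕ) : Fin m ⊕ Fin m → ℚ :=
  Sum.elim (fun v => ((l.getD v 0 : ℕ) : ℚ)) (fun v => ((l.getD (m + v) 0 : ℕ) : ℚ))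

/-- The point `G_Q(z, y) = (Δ_0(Q)(z,y), …, Δ_{s-1}(Q)(z,y))` of the hitting set at a grid seed.
[cite: GuoKumarSaptharishiSolomon2019, Def 9 and §3.2 (arXiv p0006.txt:L39-43, p0013.txt:L24-27)] -/
def row (Q : MvPolynomial (Fin m) ℚ) (s : ℕ) (l : List ℕ) : List ℚ :=
  (List.range s).map fun j => eval (natPt m l) (delta Q j)

/-- **The candidate hitting set `G_Q({0..W-1}^{2m})`** as a list of points of `ℚ^s`.
[cite: GuoKumarSaptharishiSolomon2019, §3.2 (arXiv p0013.txt:L24-27)] -/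
def gridImage (Q : MvPolynomial (Fin m) ℚ) (s W : ℕ) : List (List ℚ) :=
  (gridLists (m + m) W).map (row Q s)

/-- Size of the grid image. [cite: GuoKumarSaptharishiSolomon2019, §3.2 (arXiv p0013.txt:L27)] -/
theorem length_gridImage (Q : MvPolynomial (Fin m) ℚ) (s W : ℕ) :
    (gridImage Q s W).length = W ^ (m + m) := by
  rw [gridImage, List.length_map, length_gridLists]

/-- Reading the `z`-block of a concatenated grid list. [folklore] -/
private theorem getD_ofFn_append_left (f g : Fin m → ℕ) (v : Fin m) :
    (List.ofFn f ++ List.ofFn g).getD v 0 = f v := by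
  rw [List.getD_eq_getElem?_getD, List.getElem?_append_left (by simp), List.getElem?_ofFn]
  simp

/-- Reading the `y`-block of a concatenated grid list. [folklore] -/
private theorem getD_ofFn_append_right (f g : Fin m → ℕ) (v : Fin m) :
    (List.ofFn f ++ List.ofFn g).getD (m + v) 0 = g v := by
  rw [List.getD_eq_getElem?_getD, List.getElem?_append_right (by simp)]
  simp

/-- Coordinates of `row`. [folklore] -/
private theorem getD_row {Q : MvPolynomial (Fin m) ℚ} {s : ℕ} {l : List ℕ} (i : Fin s) :
    (row Q s l).getD i 0 = eval (natPt m l) (delta Q i) := by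
  rw [row, List.getD_eq_getElem?_getD, List.getElem?_map, List.getElem?_range i.isLt]
  simp

/-- **Generators give hitting sets on a grid** (the step "(lem:Schwartz-Zippel) … yields an explicit
hitting set"): if `G_Q = (Δ_0(Q), …, Δ_n(Q))` is a generator for `𝒞(n+1, n+1, n+1)`, `deg Q ≤ r` and
`W > (n+1)·r`, then `G_Q({0..W-1}^{2m})` hits `𝒞(n+1, n+1, n+1)`.
[cite: GuoKumarSaptharishiSolomon2019, §3.2 (arXiv p0013.txt:L24-27); MediniShpilka2021, Obs 18] -/
theorem gridImage_hits {n r W : ℕ} (Q : MvPolynomial (Fin m) ℚ)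
    (hgen : IsGeneratorFor (gen Q n) (vpSlice ℚ (n + 1) (n + 1) (n + 1)))
    (hQ : Q.totalDegree ≤ r) (hW : (n + 1) * r < W) :
    ListHits (gridImage Q (n + 1) W) (vpSlice ℚ (n + 1) (n + 1) (n + 1)) := by
  classical
  intro f hf hf0
  set S : Finset ℚ := (Finset.range W).image (fun a : ℕ => (a : ℚ)) with hS
  have hScard : S.card = W := by
    rw [hS, Finset.card_image_of_injective _ Nat.cast_injective, Finset.card_range]
  have hdeg : ∀ v, degreeOf v (bind₁ (gen Q n) f) < S.card := fun v =>
    calc degreeOf v (bind₁ (gen Q n) f) ≤ f.totalDegree * r :=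
          MS2021.degreeOf_bind₁_le (gen Q n) v (fun i => (degreeOf_delta_le Q i v).trans hQ) f
      _ ≤ (n + 1) * r := Nat.mul_le_mul_right _ hf.1
      _ < S.card := by rw [hScard]; exact hW
  obtain ⟨x, hxS, hx⟩ :=
    MS2021.exists_eval_ne_zero_of_degreeOf_lt (bind₁ (gen Q n) f) S hdeg (hgen f hf hf0)
  have hx' : ∀ w, ∃ a : ℕ, a < W ∧ (a : ℚ) = x w := fun w => by
    obtain ⟨a, ha, hax⟩ := Finset.mem_image.mp (hxS w)
    exact ⟨a, Finset.mem_range.mp ha, hax⟩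
  choose nx hnxW hnx using hx'
  set l : List ℕ := List.ofFn (fun v : Fin m => nx (Sum.inl v)) ++
    List.ofFn (fun v : Fin m => nx (Sum.inr v)) with hl
  have hpt : natPt m l = x := by
    funext w
    cases w with
    | inl v => simp only [natPt, Sum.elim_inl, hl, getD_ofFn_append_left, hnx]
    | inr v => simp only [natPt, Sum.elim_inr, hl, getD_ofFn_append_right, hnx]
  have hlmem : l ∈ gridLists (m + m) W := by
    refine mem_gridLists.mpr ⟨by simp [hl], fun a ha => ?_⟩
    simp only [hl, List.mem_append, List.mem_ofFn] at ha
    rcases ha with ⟨v, rfl⟩ | ⟨v, rfl⟩ <;> exact hnxW _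
  refine ⟨row Q (n + 1) l, List.mem_map.mpr ⟨l, hlmem, rfl⟩, ?_⟩
  have hfun : (fun i : Fin (n + 1) => (row Q (n + 1) l).getD i 0) =
      fun i => eval x (gen Q n i) := by
    funext i; rw [getD_row, hpt]; rfl
  rw [hfun]
  simpa only [MvPolynomial.eval, eval₂Hom_bind₁] using hx

/-- The trivial hitting set `{0..s}^s` for `𝒞(s, s, s)` (polynomials of degree `≤ s` do not vanish
on a grid of side `s+1`), used below the threshold from which the hardness hypothesis applies.
[cite: GuoKumarSaptharishiSolomon2019, §3.3 (arXiv p0013.txt:L57-58, "the trivial hitting set of size (s+1)^k guaranteed by (lem:Comb-Null)")] -/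
def smallList (s : ℕ) : List (List ℚ) :=
  (gridLists s (s + 1)).map fun l => l.map fun a : ℕ => (a : ℚ)

/-- Size of the trivial hitting set. [cite: GuoKumarSaptharishiSolomon2019, §3.3 (arXiv p0013.txt:L57-58)] -/
theorem length_smallList (s : ℕ) : (smallList s).length = (s + 1) ^ s := by
  rw [smallList, List.length_map, length_gridLists]

/-- The trivial grid hits `𝒞(s, s, s)`. [cite: GuoKumarSaptharishiSolomon2019, §3.3 (arXiv p0013.txt:L57-58)] -/
theorem smallList_hits (s : ℕ) : ListHits (smallList s) (vpSlice ℚ s s s) := by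
  classical
  intro f hf hf0
  set S : Finset ℚ := (Finset.range (s + 1)).image (fun a : ℕ => (a : ℚ)) with hS
  have hScard : S.card = s + 1 := by
    rw [hS, Finset.card_image_of_injective _ Nat.cast_injective, Finset.card_range]
  obtain ⟨a, haS, ha⟩ := FSV2018.exists_eval_ne_zero_of_totalDegree_lt hf0 S
    (by rw [hScard]; exact Nat.lt_succ_of_le hf.1)
  have ha' : ∀ i, ∃ b : ℕ, b < s + 1 ∧ (b : ℚ) = a i := fun i => by
    obtain ⟨b, hb, hba⟩ := Finset.mem_image.mp (haS i)
    exact ⟨b, Finset.mem_range.mp hb, hba⟩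
  choose na hnaW hna using ha'
  refine ⟨(List.ofFn na).map fun b : ℕ => (b : ℚ), List.mem_map.mpr ⟨List.ofFn na,
    mem_gridLists.mpr ⟨by simp, fun b hb => ?_⟩, rfl⟩, ?_⟩
  · obtain ⟨i, rfl⟩ := List.mem_ofFn.mp hb
    exact hnaW i
  · have hfun : (fun i : Fin s => ((List.ofFn na).map fun b : ℕ => (b : ℚ)).getD i 0) = a := by
      funext i
      rw [List.getD_eq_getElem?_getD, List.getElem?_map, List.getElem?_ofFn]
      simp [hna]
    rw [hfun]; exact ha

end Grid

/-! ### Parameters of the proof for constant `k` -/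

section Params

variable {k : ℕ}

/-- `β(s) = E·(⌊log₂ s⌋ + 1)`: the base of the splitting is `B = 2^{β(s)} ∈ (s^E, (2s)^E]`.
[cite: GuoKumarSaptharishiSolomon2019, proof of Thm 25 (arXiv p0013.txt:L12-17, base "d^{1/t}")] -/
def beta (E s : ℕ) : ℕ := E * (Nat.log 2 s + 1)

/-- The degree used at size `s`: `d(s) = s^{tE}` (printed: the smallest `d > s^{(10tk+2)t}`; any
polynomially related choice works for constant `k`). [cite: GuoKumarSaptharishiSolomon2019, proof of Thm 25 (arXiv p0013.txt:L12-13)] -/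
def dOf (t E s : ℕ) : ℕ := s ^ (t * E)

/-- `Q(s) = Q_{k,d(s),t}` in base `2^{β(s)}`. [cite: GuoKumarSaptharishiSolomon2019, proof of Thm 25 (arXiv p0013.txt:L14-17)] -/
def Qof (P : ℕ → MvPolynomial (Fin k) ℚ) (t E s : ℕ) : MvPolynomial (Fin (k * t)) ℚ :=
  kron t (2 ^ beta E s) (P (dOf t E s))

/-- Number of blocks `t = ⌈6(c+1)/δ⌉ + 1` (printed `⌈8/δ⌉` for the printed exponent `4`; `c` is the
exponent of the tree's main theorem). [cite: GuoKumarSaptharishiSolomon2019, proof of Thm 25 (arXiv p0013.txt:L12 "Let t = ⌈8/δ⌉")] -/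
def tOf (c : ℕ) (δ : ℝ) : ℕ := ⌈6 * ((c : ℝ) + 1) / δ⌉₊ + 1

/-- The exponent `E = 4kt + 2` of the degree schedule. [cite: GuoKumarSaptharishiSolomon2019, proof of Thm 25 (arXiv p0013.txt:L12-13)] -/
def EOf (k t : ℕ) : ℕ := 4 * (k * t) + 2

/-- Grid side `W(s) = s·(kt·2^{β(s)}) + 1 > s · deg Q(s)`. [cite: GuoKumarSaptharishiSolomon2019, §3.2 (arXiv p0013.txt:L27 "(sd'+1)")] -/
def WOf (k t E s : ℕ) : ℕ := s * (k * t * 2 ^ beta E s) + 1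

/-- The hitting set at size `s ≥ s₀`: `G_{Q(s)}({0..W(s)-1}^{2kt})`. [cite: GuoKumarSaptharishiSolomon2019, §3.2 (arXiv p0013.txt:L24-27)] -/
def mainList (P : ℕ → MvPolynomial (Fin k) ℚ) (t E s : ℕ) : List (List ℚ) :=
  gridImage (Qof P t E s) s (WOf k t E s)

/-- **The explicit hitting-set family of ‹Thm 5›**: the trivial grid below the threshold `s₀`, the
grid image of `G_{Q(s)}` from `s₀` on. [cite: GuoKumarSaptharishiSolomon2019, Thm 5 and §3.2 (arXiv p0005.txt:L28-31, p0013.txt:L24-27)] -/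
def hitList (P : ℕ → MvPolynomial (Fin k) ℚ) (t E s₀ s : ℕ) : List (List ℚ) :=
  if s < s₀ then smallList s else mainList P t E s

/-- `s^E < 2^{β(s)}`. [cite: GuoKumarSaptharishiSolomon2019, proof of Thm 25 (arXiv p0013.txt:L12-17)] -/
theorem pow_lt_two_pow_beta {E : ℕ} (hE : E ≠ 0) (s : ℕ) : s ^ E < 2 ^ beta E s := by
  rw [beta, pow_mul']
  · exact Nat.pow_lt_pow_left (Nat.lt_pow_succ_log_self one_lt_two s) hE

/-- `2^{β(s)} ≤ 2^E · s^E` for `s ≥ 1`. [cite: GuoKumarSaptharishiSolomon2019, proof of Thm 25 (arXiv p0013.txt:L12-17)] -/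
theorem two_pow_beta_le {E s : ℕ} (hs : 1 ≤ s) : 2 ^ beta E s ≤ 2 ^ E * s ^ E := by
  rw [beta, mul_comm E, pow_mul, ← mul_pow]
  apply Nat.pow_le_pow_left
  rw [pow_succ']
  exact Nat.mul_le_mul_left 2 (Nat.pow_log_le_self 2 (by omega))

/-- `β(s) ≤ E (s + 1)`. [cite: GuoKumarSaptharishiSolomon2019, proof of Thm 25 (arXiv p0013.txt:L18-21, "O(kt log d)")] -/
theorem beta_le (E s : ℕ) : beta E s ≤ E * (s + 1) := by
  unfold beta
  gcongr
  exact (Nat.log_le_self 2 s)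

/-- `d(s) < B(s)^t`: every exponent of `P_{d(s)}` has `t` base-`B` digits. [cite: GuoKumarSaptharishiSolomon2019, proof of Thm 25 (arXiv p0013.txt:L14-17)] -/
theorem dOf_lt {t E : ℕ} (ht : t ≠ 0) (hE : E ≠ 0) (s : ℕ) : dOf t E s < (2 ^ beta E s) ^ t := by
  rw [dOf, mul_comm, pow_mul]
  exact Nat.pow_lt_pow_left (pow_lt_two_pow_beta hE s) ht

/-- `deg Q(s) ≤ kt · 2^{β(s)}`. [cite: GuoKumarSaptharishiSolomon2019, proof of Thm 25 (arXiv p0013.txt:L14 "degree at most d' = (kt)·d^{1/t}")] -/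
theorem totalDegree_Qof_le (P : ℕ → MvPolynomial (Fin k) ℚ) (t E s : ℕ) :
    (Qof P t E s).totalDegree ≤ k * t * 2 ^ beta E s :=
  (totalDegree_kron_le t _ (Nat.two_pow_pos _) _).trans (Nat.mul_le_mul_left _ (Nat.sub_le _ _))

/-- The polynomial bookkeeping of the proof: with `B ≤ 2^E s^E`, `n ≤ s`, `β ≤ E(s+1)`, the
main-theorem threshold plus the substitution cost is `≤ A · s^L`,
`L = c(3E + 10m + 2) + 1`. [cite: GuoKumarSaptharishiSolomon2019, proof of Thm 25 (arXiv p0013.txt:L18-23)] -/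
theorem threshold_le {m E t c s n B β : ℕ} (hs : 1 ≤ s) (hn : n ≤ s) (hB : B ≤ 2 ^ E * s ^ E)
    (hβ : β ≤ E * (s + 1)) :
    (s * s * (m * B) ^ 3 * n ^ (10 * m) + 2) ^ c + m * (β * t) ≤
      ((m ^ 3 * (2 ^ E) ^ 3 + 2) ^ c + 2 * m * E * t) * s ^ (c * (3 * E + 10 * m + 2) + 1) := by
  set L₀ := 3 * E + 10 * m + 2 with hL₀
  have hsL : ∀ a : ℕ, 1 ≤ s ^ a := fun a => Nat.one_le_pow _ _ hs
  have h1 : s * s * (m * B) ^ 3 * n ^ (10 * m) + 2 ≤ (m ^ 3 * (2 ^ E) ^ 3 + 2) * s ^ L₀ := by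
    calc s * s * (m * B) ^ 3 * n ^ (10 * m) + 2
        ≤ s * s * (m * (2 ^ E * s ^ E)) ^ 3 * s ^ (10 * m) + 2 * s ^ L₀ := by
          gcongr
          · exact le_mul_of_one_le_right (by norm_num) (hsL _)
      _ = (m ^ 3 * (2 ^ E) ^ 3 + 2) * s ^ L₀ := by rw [hL₀]; ring
  have h2 : (s * s * (m * B) ^ 3 * n ^ (10 * m) + 2) ^ c ≤
      (m ^ 3 * (2 ^ E) ^ 3 + 2) ^ c * s ^ (c * L₀ + 1) := by
    calc (s * s * (m * B) ^ 3 * n ^ (10 * m) + 2) ^ c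
        ≤ ((m ^ 3 * (2 ^ E) ^ 3 + 2) * s ^ L₀) ^ c := Nat.pow_le_pow_left h1 c
      _ = (m ^ 3 * (2 ^ E) ^ 3 + 2) ^ c * s ^ (c * L₀) := by rw [mul_pow, ← pow_mul s L₀ c, mul_comm L₀ c]
      _ ≤ (m ^ 3 * (2 ^ E) ^ 3 + 2) ^ c * s ^ (c * L₀ + 1) :=
          Nat.mul_le_mul_left _ (Nat.pow_le_pow_right hs (Nat.le_succ _))
  have h3 : m * (β * t) ≤ 2 * m * E * t * s ^ (c * L₀ + 1) := by
    calc m * (β * t) ≤ m * (E * (s + 1) * t) := by gcongr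
      _ ≤ m * (E * (2 * s) * t) := by gcongr; omega
      _ = 2 * m * E * t * s := by ring
      _ ≤ 2 * m * E * t * s ^ (c * L₀ + 1) :=
          Nat.mul_le_mul_left _ (le_self_pow hs (Nat.succ_ne_zero _))
  calc _ ≤ (m ^ 3 * (2 ^ E) ^ 3 + 2) ^ c * s ^ (c * L₀ + 1) + 2 * m * E * t * s ^ (c * L₀ + 1) :=
        add_le_add h2 h3
    _ = _ := by rw [hL₀]; ring

/-- The exponent comparison: `L = c(3E+10m+2)+1 < tEδ` for `t = tOf c δ`, `E = EOf k t`, `m = kt`.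
[cite: GuoKumarSaptharishiSolomon2019, proof of Thm 25 (arXiv p0013.txt:L18-23, "d'^4 < d^{δ/2+o(1)} … ≪ d^δ")] -/
theorem exponent_lt {c : ℕ} {δ : ℝ} (hδ : 0 < δ) (hk : 0 < k) :
    ((c * (3 * EOf k (tOf c δ) + 10 * (k * tOf c δ) + 2) + 1 : ℕ) : ℝ) <
      (tOf c δ : ℝ) * (EOf k (tOf c δ)) * δ := by
  set t := tOf c δ with ht
  set E := EOf k t with hE
  have ht1 : 6 * ((c : ℝ) + 1) ≤ (t : ℝ) * δ := by
    have h1 : 6 * ((c : ℝ) + 1) / δ ≤ ⌈6 * ((c : ℝ) + 1) / δ⌉₊ := Nat.le_ceil _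
    have h2 : (⌈6 * ((c : ℝ) + 1) / δ⌉₊ : ℝ) ≤ t := by
      rw [ht, tOf]; push_cast; linarith
    rw [div_le_iff₀ hδ] at h1
    nlinarith
  have htpos : 0 < t := by rw [ht, tOf]; omega
  have hm : 1 ≤ k * t := Nat.one_le_iff_ne_zero.mpr (Nat.mul_ne_zero hk.ne' htpos.ne')
  -- `L ≤ (c+1)(3E+10m+2) < (c+1)·6E ≤ tδ·E`
  have hnat : c * (3 * E + 10 * (k * t) + 2) + 1 ≤ (c + 1) * (3 * E + 10 * (k * t) + 2) := by
    nlinarith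
  have hlt : 3 * E + 10 * (k * t) + 2 < 6 * E := by rw [hE, EOf]; omega
  have hE0 : (0 : ℝ) < E := by rw [hE, EOf]; positivity
  calc ((c * (3 * E + 10 * (k * t) + 2) + 1 : ℕ) : ℝ)
      ≤ ((c + 1) * (3 * E + 10 * (k * t) + 2) : ℕ) := by exact_mod_cast hnat
    _ < ((c + 1) * (6 * E) : ℕ) := by exact_mod_cast Nat.mul_lt_mul_of_pos_left hlt (Nat.succ_pos c)
    _ = 6 * ((c : ℝ) + 1) * E := by push_cast; ring
    _ ≤ (t : ℝ) * δ * E := by nlinarith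
    _ = (t : ℝ) * E * δ := by ring

/-- Eventually `A·s^L < s^α` for `L < α`. [folklore] -/
private theorem eventually_mul_pow_lt_rpow (A L : ℕ) {α : ℝ} (hL : (L : ℝ) < α) :
    ∃ s₂ : ℕ, ∀ s : ℕ, s₂ ≤ s → (A : ℝ) * (s : ℝ) ^ L < (s : ℝ) ^ α := by
  have hpos : 0 < α - L := by linarith
  have ht : Tendsto (fun s : ℕ => (s : ℝ) ^ (α - L)) atTop atTop :=
    (tendsto_rpow_atTop hpos).comp tendsto_natCast_atTop_atTop
  have hev := (ht.eventually_gt_atTop (A : ℝ)).and (eventually_ge_atTop 1)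
  obtain ⟨s₂, hs₂⟩ := eventually_atTop.mp hev
  refine ⟨s₂, fun s hs => ?_⟩
  obtain ⟨hA, hs1⟩ := hs₂ s hs
  have hs0 : (0 : ℝ) < s := by exact_mod_cast hs1
  have hsplit : (s : ℝ) ^ α = (s : ℝ) ^ (L : ℝ) * (s : ℝ) ^ (α - L) := by
    rw [← Real.rpow_add hs0]; congr 1; ring
  rw [hsplit, Real.rpow_natCast]
  have hsL : (0 : ℝ) < (s : ℝ) ^ L := pow_pos hs0 L
  calc (A : ℝ) * (s : ℝ) ^ L = (s : ℝ) ^ L * A := mul_comm _ _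
    _ < (s : ℝ) ^ L * (s : ℝ) ^ (α - L) := mul_lt_mul_of_pos_left hA hsL

/-- **Hardness of `Q(s)` and the main theorem give the generator property, for all large `s`.**
From `s₁` on (`s = n + 1`): `d(s) ≥ d₀`, the substitution cost `kt·β t` and the threshold
`(s·s·deg(Q)^3·n^{10kt} + 2)^c` of ‹G_P is an HSG› are together below `d(s)^δ ≤ L(P_{d(s)}) ≤
L(Q(s)) + kt·βt`, so `G_{Q(s)}` is a generator for `vpSlice ℚ s s s`.
[cite: GuoKumarSaptharishiSolomon2019, proof of Thm 25 (arXiv p0013.txt:L18-24)] -/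
theorem isGeneratorFor_Qof (hk : 0 < k) {δ : ℝ} (hδ : 0 < δ) {c : ℕ}
    (hc : ∀ (F : Type) [Field F] [CharZero F] (k d n D s : ℕ) (P : MvPolynomial (Fin k) F),
      0 < k → 0 < d → 0 < n → 0 < D → 0 < s → P.totalDegree = d →
      (s * D * d ^ 3 * n ^ (10 * k) + 2) ^ c < complexity P →
      IsGeneratorFor (gen P n) (vpSlice F (n + 1) D s))
    (P : ℕ → MvPolynomial (Fin k) ℚ) (hdeg : ∀ d, 1 ≤ d → (P d).totalDegree = d)
    (hhard : ∃ d₀ : ℕ, ∀ d, d₀ ≤ d → (d : ℝ) ^ δ ≤ (complexity (P d) : ℝ)) :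
    ∃ s₁ : ℕ, 2 ≤ s₁ ∧ ∀ n : ℕ, s₁ ≤ n + 1 →
      IsGeneratorFor (gen (Qof P (tOf c δ) (EOf k (tOf c δ)) (n + 1)) n)
        (vpSlice ℚ (n + 1) (n + 1) (n + 1)) := by
  obtain ⟨d₀, hd₀⟩ := hhard
  set t := tOf c δ with ht
  set E := EOf k t with hE
  set m := k * t with hm
  have htpos : 0 < t := by rw [ht, tOf]; omega
  have hmpos : 0 < m := Nat.mul_pos hk htpos
  have hEpos : 0 < E := by rw [hE, EOf]; omega
  set A := (m ^ 3 * (2 ^ E) ^ 3 + 2) ^ c + 2 * m * E * t with hA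
  set L := c * (3 * E + 10 * m + 2) + 1 with hL
  obtain ⟨s₂, hs₂⟩ := eventually_mul_pow_lt_rpow A L (α := (t : ℝ) * E * δ)
    (by rw [hL, hm]; exact exponent_lt hδ hk)
  refine ⟨max (max s₂ d₀) 2, le_max_right _ _, fun n hn => ?_⟩
  have hs2 : s₂ ≤ n + 1 := le_trans (le_trans (le_max_left _ _) (le_max_left _ _)) hn
  have hd0 : d₀ ≤ n + 1 := le_trans (le_trans (le_max_right _ _) (le_max_left _ _)) hn
  have hs1 : 1 ≤ n + 1 := Nat.succ_pos n
  -- the objects at size `s = n + 1`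
  set s := n + 1 with hs
  set d := dOf t E s with hd
  set B := 2 ^ beta E s with hB
  have htE : t * E ≠ 0 := Nat.mul_ne_zero htpos.ne' hEpos.ne'
  have hds : s ≤ d := by rw [hd, dOf]; exact Nat.le_self_pow htE s
  have hd1 : 1 ≤ d := hs1.trans hds
  have hPdeg : (P d).totalDegree = d := hdeg d hd1
  have hdB : (P d).totalDegree < B ^ t := by
    rw [hPdeg, hd, hB]; exact dOf_lt htpos.ne' hEpos.ne' s
  set Q := Qof P t E s with hQ
  have hQdef : Q = kron t B (P d) := rfl
  have hQpos : 0 < Q.totalDegree := by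
    rw [hQdef]; exact totalDegree_kron_pos t B (P d) hdB (by rw [hPdeg]; exact hd1)
  have hQle : Q.totalDegree ≤ m * B := totalDegree_Qof_le P t E s
  -- hardness transfer through the substitution
  have hcost : complexity (P d) ≤ complexity Q + m * (beta E s * t) := by
    have h := complexity_le_complexity_kron_add t (beta E s) (P d) hdB
    rw [← hQdef] at h
    simpa [hm] using h
  -- hardness of `P_d`
  have hhard : (s : ℝ) ^ ((t : ℝ) * E * δ) ≤ (complexity (P d) : ℝ) := by
    have h1 := hd₀ d (hd0.trans hds)
    have h2 : ((d : ℕ) : ℝ) ^ δ = (s : ℝ) ^ ((t : ℝ) * E * δ) := by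
      rw [hd, dOf, Nat.cast_pow, ← Real.rpow_natCast, ← Real.rpow_mul (Nat.cast_nonneg _)]
      push_cast; ring_nf
    rw [← h2]; exact h1
  -- the threshold of the main theorem is below the hardness
  have hthr : (s * s * (m * B) ^ 3 * n ^ (10 * m) + 2) ^ c + m * (beta E s * t) ≤ A * s ^ L :=
    threshold_le hs1 (Nat.le_succ n) (two_pow_beta_le hs1) (beta_le E s)
  have hAs : (A : ℝ) * (s : ℝ) ^ L < (s : ℝ) ^ ((t : ℝ) * E * δ) := hs₂ s hs2
  have hineq : (s * s * Q.totalDegree ^ 3 * n ^ (10 * m) + 2) ^ c < complexity Q := by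
    have h1 : (s * s * Q.totalDegree ^ 3 * n ^ (10 * m) + 2) ^ c ≤
        (s * s * (m * B) ^ 3 * n ^ (10 * m) + 2) ^ c := by gcongr
    have h2 : (((s * s * (m * B) ^ 3 * n ^ (10 * m) + 2) ^ c + m * (beta E s * t) : ℕ) : ℝ) <
        (complexity (P d) : ℝ) :=
      calc (((s * s * (m * B) ^ 3 * n ^ (10 * m) + 2) ^ c + m * (beta E s * t) : ℕ) : ℝ)
          ≤ ((A * s ^ L : ℕ) : ℝ) := by exact_mod_cast hthr
        _ = (A : ℝ) * (s : ℝ) ^ L := by push_cast; ring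
        _ < (s : ℝ) ^ ((t : ℝ) * E * δ) := hAs
        _ ≤ _ := hhard
    have h3 : (s * s * (m * B) ^ 3 * n ^ (10 * m) + 2) ^ c + m * (beta E s * t) <
        complexity (P d) := by exact_mod_cast h2
    omega
  have hnpos : 0 < n := by
    have := le_trans (le_max_right _ _) hn
    omega
  exact hc ℚ m Q.totalDegree n s s Q hmpos hQpos hnpos (Nat.succ_pos n) (Nat.succ_pos n) rfl hineq

/-- The grid image of `G_{Q(s)}` hits `𝒞(s, s, s)` once `G_{Q(s)}` is a generator (`s = n + 1`).
[cite: GuoKumarSaptharishiSolomon2019, §3.2 (arXiv p0013.txt:L24-27)] -/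
theorem mainList_hits {P : ℕ → MvPolynomial (Fin k) ℚ} {t E n : ℕ}
    (hgen : IsGeneratorFor (gen (Qof P t E (n + 1)) n) (vpSlice ℚ (n + 1) (n + 1) (n + 1))) :
    ListHits (mainList P t E (n + 1)) (vpSlice ℚ (n + 1) (n + 1) (n + 1)) :=
  gridImage_hits _ hgen (totalDegree_Qof_le P t E (n + 1)) (Nat.lt_succ_self _)

/-- **The family `hitList` hits `𝒞(s, s, s)` for every `s`** (trivial grid below the threshold,
generator grid from it on). [cite: GuoKumarSaptharishiSolomon2019, Thm 5 (arXiv p0005.txt:L28-31) via §3.2 (p0013.txt:L24-27)] -/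
theorem hitList_hits {P : ℕ → MvPolynomial (Fin k) ℚ} {t E s₁ : ℕ} (hs₁ : 1 ≤ s₁)
    (hgen : ∀ n, s₁ ≤ n + 1 →
      IsGeneratorFor (gen (Qof P t E (n + 1)) n) (vpSlice ℚ (n + 1) (n + 1) (n + 1))) (s : ℕ) :
    ListHits (hitList P t E s₁ s) (vpSlice ℚ s s s) := by
  unfold hitList
  split_ifs with h
  · exact smallList_hits s
  · obtain ⟨n, rfl⟩ : ∃ n, s = n + 1 := ⟨s - 1, by omega⟩
    exact mainList_hits (hgen n (not_lt.mp h))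

/-- Size of the generator grid: `|G_{Q(s)}({0..W-1}^{2kt})| ≤ (kt·2^E + 1)^{2kt} · s^{(E+1)·2kt}`.
[cite: GuoKumarSaptharishiSolomon2019, §3.2 (arXiv p0013.txt:L27-31, "(sd'+1)^{2t·k} ≤ s^{O(k²)}")] -/
theorem length_mainList_le {P : ℕ → MvPolynomial (Fin k) ℚ} {t E s : ℕ} (hs : 1 ≤ s) :
    (mainList P t E s).length ≤
      (k * t * 2 ^ E + 1) ^ (k * t + k * t) * s ^ ((E + 1) * (k * t + k * t)) := by
  rw [mainList, length_gridImage, pow_mul, ← mul_pow, WOf]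
  apply Nat.pow_le_pow_left
  calc s * (k * t * 2 ^ beta E s) + 1 ≤ s * (k * t * (2 ^ E * s ^ E)) + s ^ (E + 1) := by
        gcongr
        · exact two_pow_beta_le hs
        · exact Nat.one_le_pow _ _ hs
    _ = (k * t * 2 ^ E + 1) * s ^ (E + 1) := by ring

/-- **Polynomial size**: `|hitList s| ≤ s^C + C` for a constant `C` (threshold `s₀ ≥ 2`).
[cite: GuoKumarSaptharishiSolomon2019, Thm 5 (arXiv p0005.txt:L30-31, "explicit hitting sets of size poly_{δ,k}(s)")] -/
theorem length_hitList_le (P : ℕ → MvPolynomial (Fin k) ℚ) (t E : ℕ) {s₀ : ℕ} (hs₀ : 2 ≤ s₀) :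
    ∃ C : ℕ, ∀ s, (hitList P t E s₀ s).length ≤ s ^ C + C := by
  set A₁ := (k * t * 2 ^ E + 1) ^ (k * t + k * t) with hA₁
  set C₁ := (E + 1) * (k * t + k * t) with hC₁
  refine ⟨max (A₁ + C₁) ((s₀ + 1) ^ s₀), fun s => ?_⟩
  unfold hitList
  split_ifs with h
  · rw [length_smallList]
    calc (s + 1) ^ s ≤ (s₀ + 1) ^ s := Nat.pow_le_pow_left (by omega) _
      _ ≤ (s₀ + 1) ^ s₀ := Nat.pow_le_pow_right (by omega) h.le
      _ ≤ max (A₁ + C₁) ((s₀ + 1) ^ s₀) := le_max_right _ _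
      _ ≤ _ := le_add_self
  · have hs2 : 2 ≤ s := le_trans hs₀ (not_lt.mp h)
    have hs : 1 ≤ s := le_trans one_le_two hs2
    calc (mainList P t E s).length ≤ A₁ * s ^ C₁ := length_mainList_le hs
      _ ≤ s ^ A₁ * s ^ C₁ := Nat.mul_le_mul_right _
          (Nat.lt_two_pow_self.le.trans (Nat.pow_le_pow_left hs2 _))
      _ = s ^ (A₁ + C₁) := (pow_add _ _ _).symm
      _ ≤ s ^ max (A₁ + C₁) ((s₀ + 1) ^ s₀) := Nat.pow_le_pow_right hs (le_max_left _ _)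
      _ ≤ _ := Nat.le_add_right _ _

end Params

end GKSS2019

end Literature.Computability.AlgebraicComplexity

end
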